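/-
Copyright (c) 2026 the pub-hodgecm-mathlib formalisation cell (harness21).  Prover seat hodgecm-mathlib-F0P2-p02 (g11): road «S3-tree» (architect A-p16 (g30) rulings
A-96 (2) ∕ A-102 (3) «CAYLEY SHIFT ON CONJUGACY CLASSES», organ (a) of the LIFT `_le_one ↦ _le_two`; END F0P3a-p03 (g15)), 2026-09-01.
-/
import Literature.NumberTheory.Automorphic.MatrixMoebiusShift   -- ★ F0P2-p06 (g10) α: the Möbius shift `φ(M) = (a•M + b•1)(b•M + a•1)⁻¹`, `moebius_conj`, `smul_add_smul_one_mulVec_of_eigenvector`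
import HarnessLib

/-!
# The Möbius shift of a matrix, continued: the INVERSE shift `ψ = φ_{a,−b}` (`ψ(φ M) = M`), eigenvectors over a ring, and determinant bookkeeping
# (Weyl 1939, Chap. II §10; Kottwitz 1986 §3)

Topic `NumberTheory/Automorphic`; namespace `Literature.NumberTheory.Automorphic.MoebiusShift` (that of ★ `MatrixMoebiusShift`).  THEOREMS ONLY (no definition, no instance,
no notation, no named fact, no `sorry`); Mathlib + ★ α only, any commutative ring, any finite index type.  Cell `pub/hodgecm-mathlib` (D-0151), crux H413 =
`stmt-HodgeConjecture-24833`; road «S3-tree», LIFT `_le_one ↦ _le_two` of the partial head `localTransferAtOne_of_hyperspecialLevel_le_two` (END F0P3a-p03 (g15)),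
organ (a) «Cayley shift on conjugacy classes» (architect A-p16 (g30) A-96 (2), A-102 (3); seat F0P2-p02 (g11); census 2026-09-01T19:00Z F0∕P3a bus) — FILE A
(generic algebra); FILE B (`Rogawski1990/FinExplicitTransferFactorCayleyShiftSum`) is the CM class bijection and the reindexed `Δ‴`-weighted sum.

THE MATHEMATICS.  `φ_{a,b}(M) := (a•M + b•1)·(b•M + a•1)⁻¹` (★ α; the Cayley shift of the S3-tree is `a = c + 1`, `b = c − 1`, `c = ϖ_v`).  The Möbius matrix
`[[a, b], [b, a]]` has inverse `∝ [[a, −b], [−b, a]]`, so the INVERSE SHIFT is `ψ := φ_{a,−b}`: with `D := b•M + a•1`,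
`(−b)•φ(M) + a•1 = (a² − b²)•D⁻¹` and `a•φ(M) + (−b)•1 = (a² − b²)•(M·D⁻¹)` (§1), hence **`ψ(φ(M)) = M`** whenever `det D` and `a² − b²` are units (§1
`moebius_neg_moebius`; the symmetric statement `φ(ψ M′) = M′` is the same lemma at `−b`), and the `ψ`-denominator of `φ(M)` has unit determinant
(`isUnit_det_neg_smul_moebius_add_smul_one`) — the two facts that make `M ↦ φ(M)` a BIJECTION between the stable classes of `γ` and of its shift.
§2: over a commutative RING a `μ`-eigenvector of `M` with `bμ + a` a unit is a `(aμ + b)(bμ + a)⁻¹`-eigenvector of `φ(M)` (★ α has the field version);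
§3: `det(b•(PMP⁻¹) + a•1) = det(b•M + a•1)` (the denominator condition is a CLASS function) and `det φ(M)` is a unit when `det(a•M + b•1)`, `det(b•M + a•1)` are.
HONEST LABEL: HC_CM is proved only modulo the 2 remaining named inputs (hLiu418 24832, h413 24833) until rung 0 closes; elementary matrix algebra, asserts nothing printed.

## References
* [Weyl1939] H. Weyl, *The Classical Groups* (1939), Chap. II §10 (Cayley's rational parametrisation; Möbius maps of matrices).
* [Kottwitz1986] R. E. Kottwitz, *Base change for unit elements of Hecke algebras*, Compositio Math. 60 (1986), §3 (the shift `γ ↦ 1 + ϖ⁻¹(γ − 1)`).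
* [HornJohnson2013] R. A. Horn, C. R. Johnson, *Matrix Analysis*, 2nd ed. (2013), §0.8.2 (inverse of a product, similarity), §1.1 (eigenvectors of polynomials in a matrix).
-/

set_option autoImplicit false

open scoped Matrix

namespace Literature.NumberTheory.Automorphic.MoebiusShift

variable {R : Type*} [CommRing R] {n : Type*} [Fintype n] [DecidableEq n]

/-! ## §1 The inverse shift `ψ = φ_{a,−b}` -/

/-- **The `ψ`-denominator of `φ(M)`**: `(−b)•φ(M) + a•1 = (a² − b²)•(b•M + a•1)⁻¹`. [cite: Weyl1939, Chap. II §10] -/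
theorem neg_smul_moebius_add_smul_one (M : Matrix n n R) (a b : R) (hD : IsUnit (b • M + a • (1 : Matrix n n R)).det) :
    (-b) • ((a • M + b • (1 : Matrix n n R)) * (b • M + a • (1 : Matrix n n R))⁻¹) + a • (1 : Matrix n n R) =
      (a ^ 2 - b ^ 2) • (b • M + a • (1 : Matrix n n R))⁻¹ := by
  set D : Matrix n n R := b • M + a • 1 with hDdef
  have h1 : D * D⁻¹ = 1 := Matrix.mul_nonsing_inv D hD
  have key : (-b) • (a • M + b • (1 : Matrix n n R)) + a • D = (a ^ 2 - b ^ 2) • (1 : Matrix n n R) := by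
    rw [hDdef, smul_add, smul_add, smul_smul, smul_smul, smul_smul, smul_smul]
    module
  have e1 : ((-b) • (a • M + b • (1 : Matrix n n R)) + a • D) * D⁻¹ = (-b) • ((a • M + b • (1 : Matrix n n R)) * D⁻¹) + a • (1 : Matrix n n R) := by
    rw [add_mul, smul_mul_assoc, smul_mul_assoc, h1]
  rw [← e1, key, smul_mul_assoc, Matrix.one_mul]

/-- **The `ψ`-numerator of `φ(M)`**: `a•φ(M) + (−b)•1 = (a² − b²)•(M·(b•M + a•1)⁻¹)`. [cite: Weyl1939, Chap. II §10] -/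
theorem smul_moebius_add_neg_smul_one (M : Matrix n n R) (a b : R) (hD : IsUnit (b • M + a • (1 : Matrix n n R)).det) :
    a • ((a • M + b • (1 : Matrix n n R)) * (b • M + a • (1 : Matrix n n R))⁻¹) + (-b) • (1 : Matrix n n R) =
      (a ^ 2 - b ^ 2) • (M * (b • M + a • (1 : Matrix n n R))⁻¹) := by
  set D : Matrix n n R := b • M + a • 1 with hDdef
  have h1 : D * D⁻¹ = 1 := Matrix.mul_nonsing_inv D hD
  have key : a • (a • M + b • (1 : Matrix n n R)) + (-b) • D = (a ^ 2 - b ^ 2) • M := by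
    rw [hDdef, smul_add, smul_add, smul_smul, smul_smul, smul_smul, smul_smul]
    module
  have e1 : (a • (a • M + b • (1 : Matrix n n R)) + (-b) • D) * D⁻¹ = a • ((a • M + b • (1 : Matrix n n R)) * D⁻¹) + (-b) • (1 : Matrix n n R) := by
    rw [add_mul, smul_mul_assoc, smul_mul_assoc, h1]
  rw [← e1, key, smul_mul_assoc]

/-- **THE INVERSE SHIFT: `ψ(φ(M)) = M`**, `ψ = φ_{a,−b}`, whenever `a² − b²` and `det(b•M + a•1)` are units (the same lemma at `−b` gives `φ(ψ M′) = M′`).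
[cite: Weyl1939, Chap. II §10] [cite: Kottwitz1986, §3] -/
theorem moebius_neg_moebius (M : Matrix n n R) {a b : R} (hab : IsUnit (a ^ 2 - b ^ 2)) (hD : IsUnit (b • M + a • (1 : Matrix n n R)).det) :
    (a • ((a • M + b • (1 : Matrix n n R)) * (b • M + a • (1 : Matrix n n R))⁻¹) + (-b) • (1 : Matrix n n R)) *
        ((-b) • ((a • M + b • (1 : Matrix n n R)) * (b • M + a • (1 : Matrix n n R))⁻¹) + a • (1 : Matrix n n R))⁻¹ = M := by
  set D : Matrix n n R := b • M + a • 1 with hDdef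
  rw [smul_moebius_add_neg_smul_one M a b hD, neg_smul_moebius_add_smul_one M a b hD]
  obtain ⟨k, hk⟩ := hab
  have hinv : ((a ^ 2 - b ^ 2) • D⁻¹)⁻¹ = (↑k⁻¹ : R) • D := by
    refine Matrix.inv_eq_right_inv ?_
    rw [smul_mul_assoc, mul_smul_comm, smul_smul, Matrix.nonsing_inv_mul D hD, ← hk, Units.mul_inv, one_smul]
  rw [hinv, smul_mul_assoc, mul_smul_comm, smul_smul, Matrix.mul_assoc, Matrix.nonsing_inv_mul D hD, Matrix.mul_one, ← hk, Units.mul_inv, one_smul]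

/-- The `ψ`-denominator of `φ(M)` has UNIT determinant (`= (a² − b²)^n · det(b•M + a•1)⁻¹`). [cite: Weyl1939, Chap. II §10] -/
theorem isUnit_det_neg_smul_moebius_add_smul_one (M : Matrix n n R) {a b : R} (hab : IsUnit (a ^ 2 - b ^ 2))
    (hD : IsUnit (b • M + a • (1 : Matrix n n R)).det) :
    IsUnit ((-b) • ((a • M + b • (1 : Matrix n n R)) * (b • M + a • (1 : Matrix n n R))⁻¹) + a • (1 : Matrix n n R)).det := by
  rw [neg_smul_moebius_add_smul_one M a b hD, Matrix.det_smul]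
  exact (hab.pow _).mul ((Matrix.isUnit_nonsing_inv_det_iff (A := b • M + a • (1 : Matrix n n R))).2 hD)


/-! ## §2 Eigenvectors over a commutative ring -/

/-- **The Möbius shift maps a `μ`-eigenvector to a `(aμ + b)(bμ + a)⁻¹`-eigenvector** over any commutative ring, when `bμ + a` is a unit and the denominator is invertible
(★ α `moebius_mulVec_of_eigenvector` is the field version). [cite: HornJohnson2013, §1.1] -/
theorem moebius_mulVec_of_eigenvector_of_isUnit {M : Matrix n n R} {p : n → R} {μ : R} (hp : M *ᵥ p = μ • p) {a b : R} (hμ : IsUnit (b * μ + a))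
    (hD : IsUnit (b • M + a • (1 : Matrix n n R)).det) :
    ((a • M + b • (1 : Matrix n n R)) * (b • M + a • (1 : Matrix n n R))⁻¹) *ᵥ p = ((a * μ + b) * (↑(hμ.unit⁻¹) : R)) • p := by
  have h3 : (b • M + a • (1 : Matrix n n R))⁻¹ *ᵥ ((b • M + a • (1 : Matrix n n R)) *ᵥ p) = p := by
    rw [Matrix.mulVec_mulVec, Matrix.nonsing_inv_mul _ hD, Matrix.one_mulVec]
  rw [smul_add_smul_one_mulVec_of_eigenvector hp, Matrix.mulVec_smul] at h3
  have h1 : (b • M + a • (1 : Matrix n n R))⁻¹ *ᵥ p = (↑(hμ.unit⁻¹) : R) • p := by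
    calc (b • M + a • (1 : Matrix n n R))⁻¹ *ᵥ p = (↑(hμ.unit⁻¹) : R) • ((b * μ + a) • ((b • M + a • (1 : Matrix n n R))⁻¹ *ᵥ p)) := by
          rw [smul_smul, hμ.val_inv_mul, one_smul]
      _ = (↑(hμ.unit⁻¹) : R) • p := by rw [h3]
  rw [← Matrix.mulVec_mulVec, h1, Matrix.mulVec_smul, smul_add_smul_one_mulVec_of_eigenvector hp, smul_smul, mul_comm]

/-! ## §3 Determinant bookkeeping: the denominator condition is a class function; `det φ(M)` is a unit -/

/-- `x•(PMP⁻¹) + y•1 = P·(x•M + y•1)·P⁻¹` for `P` with unit determinant. [cite: HornJohnson2013, §0.8.2] -/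
theorem smul_conj_add_smul_one (P M : Matrix n n R) (hP : IsUnit P.det) (x y : R) :
    x • (P * M * P⁻¹) + y • (1 : Matrix n n R) = P * (x • M + y • 1) * P⁻¹ := by
  rw [mul_add, add_mul, mul_smul_comm, smul_mul_assoc, mul_smul_comm, smul_mul_assoc, Matrix.mul_one, Matrix.mul_nonsing_inv P hP]

/-- **The denominator condition is a class function**: `det(b•(PMP⁻¹) + a•1) = det(b•M + a•1)`. [cite: HornJohnson2013, §0.8.2] -/
theorem det_smul_conj_add_smul_one (P M : Matrix n n R) (hP : IsUnit P.det) (a b : R) :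
    (b • (P * M * P⁻¹) + a • (1 : Matrix n n R)).det = (b • M + a • (1 : Matrix n n R)).det := by
  rw [smul_conj_add_smul_one P M hP b a]
  exact Matrix.det_conj ((Matrix.isUnit_iff_isUnit_det P).2 hP) _

/-- **`det φ(M)` is a unit** when the numerator and denominator determinants are. [cite: HornJohnson2013, §0.8.2] -/
theorem isUnit_det_moebius {M : Matrix n n R} {a b : R} (hN : IsUnit (a • M + b • (1 : Matrix n n R)).det) (hD : IsUnit (b • M + a • (1 : Matrix n n R)).det) :
    IsUnit ((a • M + b • (1 : Matrix n n R)) * (b • M + a • (1 : Matrix n n R))⁻¹).det := by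
  rw [Matrix.det_mul]
  exact hN.mul ((Matrix.isUnit_nonsing_inv_det_iff (A := b • M + a • (1 : Matrix n n R))).2 hD)

end Literature.NumberTheory.Automorphic.MoebiusShift
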